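import Mathlib
import HarnessLib
import Literature.Computability.Complexity.Randomized
import Literature.Computability.Complexity.RandomizedProofs
import Literature.Computability.Complexity.ProbabilisticClasses
import Literature.Computability.Complexity.Reductions
import Literature.Computability.Complexity.Space
import Literature.Computability.Complexity.PolyHierarchy
import Literature.Computability.Complexity.ParityQuantifier

/-!
# Refuters and constructive separations (Chen–Jin–Santhanam–Williams, FOCS 2021)

Topic `Literature/Computability/MetaComplexity`. Vendors the notions and the uniform-class results
of

* L. Chen, C. Jin, R. Santhanam, R. Williams, *Constructive separations and their consequences*,
  FOCS 2021 (IEEE 2022), pp. 646–657 = arXiv:2203.14379 = TheoretiCS 3 (2024) [ChenEtAl2022];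
  numbering below is that of arXiv:2203.14379v5 (Def. 1.1, Thm. 1.2, Thm. 1.9; §5–§6).

A *refuter* for a language `L` against an algorithm `A` prints, on input `1ⁿ`, an `n`-bit string
on which `A` errs, for infinitely many `n` (Def. 1.1; the notion goes back to Kabanets 2000, with
Gutfreund–Shaltiel–Ta-Shma 2007 [GutfreundShaltielTashma2007] for `NP`). A `𝒟`-constructive
separation of `L ∉ 𝒞` is a `𝒟`-refuter against EVERY `𝒞`-algorithm for `L` (the refuter may
depend on the algorithm). Thm. 1.2: for `𝒞 ∈ {P, ZPP, BPP}` and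
`𝒟 ∈ {NP, Σₖᵖ, PP, PSPACE, EXP, NEXP, EXP^NP}` (and `⊕P` with `BPP`-refuters), `𝒟 ⊄ 𝒞` already
implies a `𝒞`-constructive separation of every paddable `𝒟`-complete language. Thm. 1.9: under
`NE ≠ E` some language of `NP ∖ P` has no `P`-refuter even against the constant-one algorithm.

## Contents (all statements; definitions are real, results are NAMED FACTS `def … : Prop`)

* `IsPRefuter L L'' R`, `IsBPPRefuter L L'' R` — Def. 1.1 in LANGUAGE FORM: the refuted algorithm
  `A` is presented by the language `L''` it decides, so "`A(x) ≠ L(x)`" reads `x ∈ L ∆ L''`, i.e.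
  `x ∈ L ↔ x ∉ L''`. For deterministic / bounded-gap randomized polynomial-time `A` (the only
  ones Def. 1.1 refutes: "we only consider randomized algorithms `A` with bounded probability
  gap") this is literally equivalent: such an `A` decides some `L'' ∈ P` / `∈ BPP` and errs on `x`
  iff `x ∈ L ∆ L''`; conversely every `L'' ∈ P` / `BPP` is decided by such an `A`.
  `BPP`-refuters are Gill machines `RandAlg ℕ (List Bool)` on the unary input `1ⁿ`
  (`Computability.unaryEncodeNat`) with an EXACTLY polynomial coin budget, as in
  `mem_BPP_iff_randAlg` (a merely bounded `coinLen : ℕ → ℕ` would leak advice).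
* `HasPConstructiveSeparation L 𝒞`, `HasBPPConstructiveSeparation L 𝒞` — Def. 1.1, second half;
  `hasBPPConstructiveSeparation_of_hasPConstructiveSeparation` (proved: a `P`-refuter is a
  coin-free `BPP`-refuter).
* `IsLengthPaddable L` — the padding property the proofs of §5 use ("since `L` is paddable, we may
  assume the queries to the `L`-oracle always have length exactly `ℓ(n)`").
* Named facts: `constructiveSeparation_of_not_subset_BPP 𝒟` (Thm. 1.2 with `𝒞 = BPP`, schema) and
  its printed instances `…_PSPACE`, `…_EXP`, `…_NEXP`, `…_PP`, `…_SigmaP`, `…_NP`, `…_ParityP`;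
  `pConstructiveSeparation_of_not_NP_subset_P` (Thm. 1.2 with `(𝒞, 𝒟) = (P, NP)`, the
  Gutfreund–Shaltiel–Ta-Shma case); `exists_NP_diff_P_without_PRefuter` (Thm. 1.9, first part) —
  **deprecated (mis-stated, 2026-08-15)**: its printed proof establishes the statement only from the
  hypothesis `NE ⊄ io-E`; that form is stated AND proved as
  `exists_NP_diff_P_without_PRefuter_of_not_NE_subset_ioE` (`ConstructiveSeparationsNoRefuter.lean`,
  with `NoRefuterFormat.lean`, `NoRefuterSearch.lean`, `NoRefuterLevels.lean`).

## What is NOT here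

* `EXP^NP` (no such class in the tree) and the `ZPP`-refuter variant of Def. 1.1.
* Thm. 1.9, second part (`NE ≠ RE`, no `BPP`-refuters): the one-sided-error exponential class
  `RE` is not in the tree.
* Prop. 1.8 (`R_{K^t}` has no `P`-refuter against constant zero) — see `Kolmogorov.lean` for `K^t`;
  not needed by the consumers below.
* Anything about `BQP`: the paper never treats quantum classes (its engine, §5 Thm. "Refuters for
  PSPACE, EXP, NEXP", needs closure of `𝒟` under polynomially bounded `∃`/`∀` and paddable complete
  sets). The `BQP` analogues are the OPEN route statements
  `Summit.QuantumAdvantage.QuantumAdvantage.Theses.Refuters.RefThesis` (`∃ L ∈ BQP,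
  HasBPPConstructiveSeparation L BPP`, definitionally) and `….RefAutoConstructive`; this file
  grounds their vocabulary and records the nearest printed theorems.

## Modelling notes

* Def. 1.1 asks the refuter to print an `n`-bit string on EVERY `1ⁿ` and to succeed for
  infinitely many `n`; here the length requirement is folded into the success event
  (`x.length = n ∧ …`). The two are equivalent: replacing any output of the wrong length by `0ⁿ`
  is a polynomial-time post-processing that does not change the success events.
* "for infinitely many `n` … with probability at least `2/3`" is `∃ᶠ n in atTop, 2/3 ≤ Pr[…]`; the
  constant `2/3` is the printed one and is NOT known to be amplifiable (footnote to Def. 1.1).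
-/

namespace Literature.Computability.MetaComplexity

open _root_.Computability Complexity Filter

/-! ### Definition 1.1: refuters -/

/-- **`P`-refuter (language form).** `R : ℕ → List Bool` is a `P`-refuter for the language `L`
against (any algorithm deciding) `L''`: `n ↦ R n` is computable in time polynomial in `n` from the
unary input `1ⁿ`, and for infinitely many `n` the output `R n` is an `n`-bit string of the
symmetric difference `L ∆ L''` — an input on which the refuted algorithm errs about `L`.
Printed: "a `P`-refuter for `f` against `A` is a deterministic polynomial time algorithm `R`
that, given input `1ⁿ`, prints a string `x ∈ {0,1}ⁿ`, such that for infinitely many `n`,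
`A(x) ≠ f(x)`." [cite: ChenEtAl2022, Def. 1.1] -/
def IsPRefuter (L L'' : Language Bool) (R : ℕ → List Bool) : Prop :=
  PolyTimeComputable unaryEncodeNat (id : List Bool → List Bool) R ∧
    ∃ᶠ n in atTop, (R n).length = n ∧ (R n ∈ L ↔ R n ∉ L'')

/-- **`BPP`-refuter (language form, Gill machine).** `R : RandAlg ℕ (List Bool)` is a
`BPP`-refuter for `L` against (any bounded-gap algorithm deciding) `L''`: `R` is probabilistic
polynomial time on the unary input `1ⁿ` (`RandAlg.IsPolyTime unaryEncodeNat id`), its coin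
budget is EXACTLY a polynomial in `n` (as in `mem_BPP_iff_randAlg`; a merely bounded budget
`coinLen : ℕ → ℕ` could encode advice), and for infinitely many `n`, with probability `≥ 2/3`
over its coins it outputs an `n`-bit string of `L ∆ L''`.
Printed: "A `BPP`-refuter for `f` against `A` is a randomized polynomial time algorithm `R`
that, given input `1ⁿ`, prints a string `x ∈ {0,1}ⁿ`, such that for infinitely many `n`,
`A(x) ≠ f(x)` with probability at least `2/3`" (footnote: the constant `2/3` matters, success is
not obviously amplifiable). [cite: ChenEtAl2022, Def. 1.1] -/
def IsBPPRefuter (L L'' : Language Bool) (R : RandAlg ℕ (List Bool)) : Prop :=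
  R.IsPolyTime unaryEncodeNat (id : List Bool → List Bool) ∧
    (∃ q : Polynomial ℕ, ∀ n, R.coinLen n = q.eval n) ∧
      ∃ᶠ n in atTop, (2 : ℝ) / 3 ≤ R.pr unaryEncodeNat n {x | x.length = n ∧ (x ∈ L ↔ x ∉ L'')}

/-! ### Definition 1.1: constructive separations -/

/-- **`P`-constructive separation of `L ∉ 𝒞` (language form).** Every language `L'' ∈ 𝒞` —
i.e. every `𝒞`-algorithm, presented by the language it decides — admits a `P`-refuter for `L`
against it; the refuter may depend on `L''`.
Printed: "we say there is a `𝒟`-constructive separation of `f ∉ 𝒞`, if for every algorithm `A`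
computable in `𝒞`, there is a refuter for `f` against `A` that is computable in `𝒟`. Note that we
allow the refuter algorithm to depend on the algorithm `A`." (`𝒟 = P`.) [cite: ChenEtAl2022, Def. 1.1] -/
def HasPConstructiveSeparation (L : Language Bool) (C : Set (Language Bool)) : Prop :=
  ∀ L'' ∈ C, ∃ R : ℕ → List Bool, IsPRefuter L L'' R

/-- **`BPP`-constructive separation of `L ∉ 𝒞` (language form).** Every `L'' ∈ 𝒞` admits a
`BPP`-refuter for `L` against it (the refuter may depend on `L''`). With `𝒞 = BPP` this is the
property "`L` is `BPP`-constructively separated from `BPP`"; it implies `L ∉ 𝒞` (take `L'' := L`: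
the refuter would have to hit `L ∆ L = ∅`, `not_mem_of_hasBPPConstructiveSeparation`). This is
`𝒟 = BPP` in the printed definition quoted at `HasPConstructiveSeparation`; the route statement
`Summit.QuantumAdvantage.QuantumAdvantage.Theses.Refuters.RefThesis` is literally
`∃ L ∈ BQP, HasBPPConstructiveSeparation L BPP` (checked `Iff.rfl`). [cite: ChenEtAl2022, Def. 1.1] -/
def HasBPPConstructiveSeparation (L : Language Bool) (C : Set (Language Bool)) : Prop :=
  ∀ L'' ∈ C, ∃ R : RandAlg ℕ (List Bool), IsBPPRefuter L L'' R

/-- **A `P`-refuter is a `BPP`-refuter that ignores its coins**, so a `P`-constructive separation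
is a `BPP`-constructive one: from `IsPRefuter L L'' R` take the coin-free machine
`RandAlg.ofDet R` — it is PPT (`RandAlg.IsPolyTime.ofDet_holds`), its coin budget is the zero
polynomial, and on the frequently-many good `n` its success probability is the indicator `1`
(`RandAlg.pr_ofDet`). [cite: ChenEtAl2022, Def. 1.1] -/
theorem hasBPPConstructiveSeparation_of_hasPConstructiveSeparation {L : Language Bool}
    {C : Set (Language Bool)} (h : HasPConstructiveSeparation L C) :
    HasBPPConstructiveSeparation L C := by
  intro L'' hL''
  obtain ⟨R, hR, hio⟩ := h L'' hL''
  refine ⟨RandAlg.ofDet R, RandAlg.IsPolyTime.ofDet_holds hR, ⟨0, fun n => ?_⟩, ?_⟩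
  · simp [RandAlg.ofDet]
  · refine hio.mono fun n hn => ?_
    classical
    rw [RandAlg.pr_ofDet, if_pos (show R n ∈ {x : List Bool | x.length = n ∧ (x ∈ L ↔ x ∉ L'')} from hn)]
    norm_num

/-! ### Paddability (as used in §5) -/

/-- **Length-paddable language.** There is a padding map `pad (x, m)`, computable in time
polynomial in `|x| + m` from `⟨x, 1ᵐ⟩`, which for every target length `m ≥ |x|` returns a string
of length EXACTLY `m` with the same membership in `L` as `x`. This is the form of paddability the
proofs of [ChenEtAl2022, §5] invoke ("Since `L` is paddable, we may assume the queries to the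
`L`-oracle always have length exactly `ℓ(n)`, for some strictly increasing polynomial `ℓ`"); every
class in Thm. 1.2 has complete languages of this kind (e.g. `{x 0 1ʲ : x ∈ L₀}` for a complete
`L₀`). Berman–Hartmanis paddability (an invertible padding `Σ* × Σ* → Σ*`) is a different,
stronger-in-other-respects notion and is not asserted here. [cite: ChenEtAl2022, §5.1 (proof of the theorem "Refuters for PSPACE, EXP, and NEXP")] -/
def IsLengthPaddable (L : Language Bool) : Prop :=
  ∃ pad : List Bool × ℕ → List Bool,
    PolyTimeComputable (fun p : List Bool × ℕ => boolPair p.1 (unaryEncodeNat p.2))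
        (id : List Bool → List Bool) pad ∧
      ∀ (x : List Bool) (m : ℕ), x.length ≤ m →
        (pad (x, m)).length = m ∧ (pad (x, m) ∈ L ↔ x ∈ L)

/-! ### Theorem 1.2: separations of uniform classes are automatically constructive -/

/-- **Schema of Thm. 1.2 with `𝒞 = BPP`:** "`𝒟 ⊄ BPP` implies that for every paddable
`𝒟`-complete language `L`, there is a `BPP`-constructive separation of `L ∉ BPP`"
(`𝒟`-complete = complete under Karp reductions, `IsComplete`). PRINTED ONLY for
`𝒟 ∈ {NP, Σₖᵖ (k ≥ 2), PP, PSPACE, EXP, NEXP, EXP^NP}` and, in the `BPP`-refuter form, for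
`𝒟 = ⊕P` — see the instances below; for other `𝒟` (in particular `𝒟 = BQP`, which has no known
complete languages) nothing is claimed: only the instance facts below may be assumed as hypotheses
or discharged; the schema itself is a mere abbreviation. [cite: ChenEtAl2022, Thm. 1.2] -/
def constructiveSeparation_of_not_subset_BPP (D : Set (Language Bool)) : Prop :=
  ¬ D ⊆ BPP → ∀ L : Language Bool, IsComplete D L → IsLengthPaddable L →
    HasBPPConstructiveSeparation L BPP

/-- **Thm. 1.2, `(𝒞, 𝒟) = (BPP, PSPACE)`:** if `PSPACE ⊄ BPP` then every paddable
`PSPACE`-complete language is `BPP`-constructively separated from `BPP` (proof: §5.1, via the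
closure of `PSPACE` under polynomially bounded `∃`/`∀` and a search-to-decision list-refuter).
[cite: ChenEtAl2022, Thm. 1.2] -/
def constructiveSeparation_of_not_subset_BPP_PSPACE : Prop :=
  constructiveSeparation_of_not_subset_BPP PSPACE

/-- **Thm. 1.2, `(𝒞, 𝒟) = (BPP, EXP)`.** [cite: ChenEtAl2022, Thm. 1.2] -/
def constructiveSeparation_of_not_subset_BPP_EXP : Prop :=
  constructiveSeparation_of_not_subset_BPP EXP

/-- **Thm. 1.2, `(𝒞, 𝒟) = (BPP, NEXP)`** (the Dolev–Fandina–Gutfreund 2013 case, assuming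
`NEXP ⊄ BPP`). [cite: ChenEtAl2022, Thm. 1.2] -/
def constructiveSeparation_of_not_subset_BPP_NEXP : Prop :=
  constructiveSeparation_of_not_subset_BPP NEXP

/-- **Thm. 1.2, `(𝒞, 𝒟) = (BPP, PP)`** (proof: §5.3, via the `P^PP` algorithm for `#SAT`).
The relevant printed neighbour of quantum advantage: `BQP ⊆ PP`, so `BQP ⊄ BPP` gives
`PP ⊄ BPP` and hence `BPP`-refuters for every paddable `PP`-complete language — but not for a
`BQP` language. [cite: ChenEtAl2022, Thm. 1.2] -/
def constructiveSeparation_of_not_subset_BPP_PP : Prop :=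
  constructiveSeparation_of_not_subset_BPP PP

/-- **Thm. 1.2, `(𝒞, 𝒟) = (BPP, Σₖᵖ)`, `k ≥ 1`** (proof: §5.2, adaptation of
Gutfreund–Shaltiel–Ta-Shma via a downward self-reducible complete language).
[cite: ChenEtAl2022, Thm. 1.2] -/
def constructiveSeparation_of_not_subset_BPP_SigmaP : Prop :=
  ∀ k : ℕ, 1 ≤ k → constructiveSeparation_of_not_subset_BPP (SigmaP k)

/-- **Thm. 1.2, `(𝒞, 𝒟) = (BPP, NP)`:** `NP ⊄ BPP` implies a `BPP`-constructive separation of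
every paddable `NP`-complete language from `BPP`. [cite: ChenEtAl2022, Thm. 1.2] -/
def constructiveSeparation_of_not_subset_BPP_NP : Prop :=
  constructiveSeparation_of_not_subset_BPP Nondeterministic.NP

/-- **Thm. 1.2, second sentence, `𝒞 = BPP`:** "`⊕P ⊄ 𝒞` implies that for every paddable
`⊕P`-complete language `L`, there is a `BPP`-constructive separation of `L ∉ 𝒞`" (the refuters
are randomized even for deterministic `𝒞`; proof §5.3 via Valiant–Vazirani).
[cite: ChenEtAl2022, Thm. 1.2] -/
def constructiveSeparation_of_not_subset_BPP_ParityP : Prop :=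
  constructiveSeparation_of_not_subset_BPP ParityP

/-- **Thm. 1.2, `(𝒞, 𝒟) = (P, NP)`** (the Gutfreund–Shaltiel–Ta-Shma 2007 lineage): if
`NP ⊄ P` then every paddable `NP`-complete language has a `P`-constructive separation from `P` —
against every polynomial-time algorithm a deterministic polynomial-time refuter prints inputs on
which it errs, infinitely often. [cite: ChenEtAl2022, Thm. 1.2] -/
def pConstructiveSeparation_of_not_NP_subset_P : Prop :=
  ¬ Nondeterministic.NP ⊆ Classes.P → ∀ L : Language Bool, IsNPComplete L → IsLengthPaddable L →
    HasPConstructiveSeparation L Classes.P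

/-! ### Theorem 1.9: hard languages with no refuters -/

/-- **Deprecated (2026-08-15) — mis-stated** (verdict of its prove seat, verified against the held
arXiv source of [ChenEtAl2022]: Def. 1.1 (§1.1) and §6, Proof of Thm. 1.9; the statement is kept
verbatim, unchanged; its only user is the bridge
`exists_NP_diff_P_without_PRefuter_of_not_NE_subset_ioE_of_printed` of
`ConstructiveSeparationsNoRefuter.lean`). *Intended:* **Thm. 1.9 (first part): separations that
cannot be made constructive** — "If `NE ≠ E`, then there is a language in `NP ∖ P` that does not
have `P` refuters against the constant one function." Against the constant-one algorithm
(`L'' = univ`) a refuter must print NON-members of the language, so the statement says: the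
non-members of some `L ∈ NP ∖ P` cannot be produced in polynomial time at infinitely many lengths
(proof §6: every accepted input of the complement reveals a truth table of an `NE ∖ E` language).
*What is wrong:* the statement is not established by its source. A refuter (Def. 1.1,
`IsPRefuter`) need only succeed "for infinitely many `n`", while the printed proof ends "we can use
this refuter to decide `L'` on `m`-bit inputs in `2^{O(m)}` time, contradicting `L' ∉ E`": at the
lengths where the refuter fails its output is not in the `coNP` language `L` (conditions (2)
"`tᵢ = 0 ⇒ i ∉ L'`" and (3) "`s ∉ SAT`" cannot be tested in deterministic time `2^{O(m)}`), so the
algorithm obtained decides `L'` correctly on infinitely many input lengths only, i.e. puts `L'` in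
`io-E` (the tree's `io E`, `Classes.lean`), which `L' ∉ E` does not exclude. The tree has no proof of this `Prop`
from `NE ≠ E`; do not take it as a hypothesis. *The established statement:* the same conclusion
from the almost-everywhere hypothesis `¬ NE ⊆ io E` that the last step consumes —
`exists_NP_diff_P_without_PRefuter_of_not_NE_subset_ioE`, stated and PROVED
(`exists_NP_diff_P_without_PRefuter_of_not_NE_subset_ioE_holds`) in
`ConstructiveSeparationsNoRefuter.lean` following the printed construction
(`NoRefuterFormat.lean`, `NoRefuterSearch.lean`, `NoRefuterLevels.lean`); this printed form implies
it (`…_of_printed`, since `E ⊆ io E`). *Original content (unchanged):*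
`NE ≠ E → ∃ L ∈ NP, L ∉ P ∧ ∀ R, ¬ IsPRefuter L univ R`. [cite: ChenEtAl2022, Thm. 1.9] -/
@[deprecated "mis-stated (2026-08-15): the printed proof of ChenEtAl2022 Thm. 1.9 (§6) turns a P-refuter, which by Def. 1.1 succeeds only for infinitely many n, into an algorithm deciding L' ∈ NE ∖ E on infinitely many input lengths only (L' ∈ io-E), which does not contradict L' ∉ E; the statement is therefore not established by its source from NE ≠ E. Use the proved form with the almost-everywhere hypothesis ¬ NE ⊆ io E: Literature.Computability.MetaComplexity.exists_NP_diff_P_without_PRefuter_of_not_NE_subset_ioE (and its proof …_holds, ConstructiveSeparationsNoRefuter.lean)" (since := "2026-08-15")]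
def exists_NP_diff_P_without_PRefuter : Prop :=
  NE ≠ E → ∃ L ∈ Nondeterministic.NP, L ∉ Classes.P ∧
    ∀ R : ℕ → List Bool, ¬ IsPRefuter L (Set.univ : Set (List Bool)) R

/-! ### Sanity lemmas (definitional) -/

/-- A constructive separation from a class containing `L` itself is impossible for the trivial
reason recorded in the paper's set-up: against `L'' := L` the refuter would have to hit
`L ∆ L = ∅`. Language form of "a constructive separation of `L ∉ 𝒞` implies `L ∉ 𝒞`".
[cite: ChenEtAl2022, Def. 1.1] -/
theorem not_mem_of_hasBPPConstructiveSeparation {L : Language Bool} {C : Set (Language Bool)}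
    (h : HasBPPConstructiveSeparation L C) : L ∉ C := by
  intro hL
  obtain ⟨R, -, -, hR⟩ := h L hL
  obtain ⟨n, hn⟩ := hR.exists
  have hempty : {x : List Bool | x.length = n ∧ (x ∈ L ↔ x ∉ L)} = ∅ := by
    ext x
    simp only [Set.mem_setOf_eq, Set.mem_empty_iff_false, iff_false, not_and]
    intro _ h'
    exact iff_not_self h'
  rw [hempty] at hn
  simp [RandAlg.pr] at hn
  norm_num at hn

/-- The deterministic analogue: a `P`-constructive separation of `L` from `𝒞` forces `L ∉ 𝒞`.
[cite: ChenEtAl2022, Def. 1.1] -/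
theorem not_mem_of_hasPConstructiveSeparation {L : Language Bool} {C : Set (Language Bool)}
    (h : HasPConstructiveSeparation L C) : L ∉ C := by
  intro hL
  obtain ⟨R, -, hR⟩ := h L hL
  obtain ⟨n, -, hn⟩ := hR.exists
  exact iff_not_self hn

end Literature.Computability.MetaComplexity
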